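import Literature.NumberTheory.EllipticCurves.ModularSymbolsPeriodHomology
import Literature.NumberTheory.EllipticCurves.AtkinLehnerInvolutions
import HarnessLib

/-!
# Sublattices of the period homology `H₁(X₀(N), ℤ) ⊆ S₂(Γ₀(N))^∧`: saturation, the `f`-isotypic
# sublattice, the `p`-Steinberg-old sublattice `sat(ker(U_p² − 1) + w_{Q_p} ker(U_p² − 1))`, and congruence
# of sublattices modulo `p H₁` («Old-Steinberg avoidance»)

Topic `NumberTheory/EllipticCurves`; namespace `Literature.NumberTheory.EllipticCurves.ModularForms` (that of
`periodHomology`). DEFINITIONS ONLY (with bodies) and their unfolding lemmas; no named fact, nothing asserted.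
This is the vocabulary asked for by the BSD cell `bsd-f2-manin` (planner es, MEMO-es §26, typing ask T-es-13,
2026-08-28) to state the Betti-level hypothesis of its toric-duality mechanism at an additive prime —
«OLD-STEINBERG AVOIDANCE `F̄ ∩ Ō_St = 0` in `H/2H`, `H = H₁(X₀(N), ℤ)`, `F̄ = Λ′/2Λ′`, `Λ′ = H ∩ V_f`,
`Ō_St = (H ∩ V_St)/2`, `V_St` the span of the `2`-Steinberg old forms; a finite computation in INTEGRAL
modular symbols» (es §26; engine `e26.gp`: «O_St^{sat} = sat(ker(U₂² − 1) + W₄ ker(U₂² − 1))») — over the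
tree's currency:

* the period homology `periodHomology N ⊆ S₂(Γ₀(N))^∧ = Module.Dual ℂ (CuspForm (Gamma0 N) 2)` (Cremona 1997
  §2.1; `ModularSymbolsPeriodHomology`), on which the transposed Hecke operators `T_p^∨ = (heckeT (Gamma0 N) 2 p).dualMap`
  act (`dualMap_heckeT_mem_periodHomology`; for `p ∣ N` this `T_p` IS `U_p`, Cremona (2.4.1)–(2.4.2) with the
  `𝟙_{p ∤ N}` term absent);
* the Atkin–Lehner involutions `atkinLehnerInvolution N k Q` / `atkinLehnerInvolutionAt N k p` on `S_k(Γ₀(N))`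
  (Knapp 1993 Lemma 9.24; `AtkinLehnerInvolutions`), transposed to the dual space.

## Contents

* `U_p` on INTEGRAL homology is already in the tree and is NOT redefined: `periodHomologyHecke N` (the period
  homology as a module over the integral Hecke ring `HeckeRing0 N 2`, file `ModularJacobianModPMultiplicityOne`,
  with `HeckeRing0.T p hp` acting through `dualAction`) and `dualMap_heckeT_mem_periodHomology`; below the operators
  are written `(heckeT (Gamma0 N) 2 p).dualMap` directly.
* `atkinLehnerDual N Q`, `atkinLehnerDualAt N p` — `w_Q^∨`, `w_{Q_p}^∨` on `S₂(Γ₀(N))^∧` (ambient; that they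
  preserve `H₁(X₀(N), ℤ)` is true — `w_Q` normalises `Γ₀(N)` and permutes the cusps — but is NOT asserted here;
  every lattice below is cut back to `periodHomology N` by definition).
* `periodHomologySaturation N L = {φ ∈ H | ∃ n ≥ 1, n φ ∈ L}` — the saturation `(ℚL) ∩ H` of a subgroup `L`.
* `isotypicPeriodLattice N f = {φ ∈ H | T_p^∨ φ = a_p(f) φ for all primes p}` — the `f`-isotypic sublattice
  `Λ′_f = H ∩ V_f` (`a_p(f) = ` the `q`-expansion coefficient, as in `IsNewform0.heckeT_eq_coeff_smul`).
* `steinbergKernel N p = {φ ∈ H | U_p^∨(U_p^∨ φ) = φ}` and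
  `steinbergOldPeriodLattice N p = sat_H( ⟨ steinbergKernel ∪ w_{Q_p}^∨(steinbergKernel) ⟩ )` — es's
  `O_St^{sat}`: at `N = 4M`, `p = 2`, the `2`-Steinberg old packets `{g, g|B₂}` (`g` new of level `2d′`,
  `a₂(g) = ±1`) have `U₂ = (a₂ 1; 0 0)`, so `ker(U₂² − 1)` is the line of `g` and `w_4` supplies the other
  old direction (MEMO-es §26.2).
* `AvoidsModP N p A B` — «`Ā ∩ B̄ = 0` in `H/pH`» for subgroups `A, B` cut back to `H`: an element of `A ∩ H`
  congruent mod `p H` to an element of `B ∩ H` lies in `p H`; and the cell's hypothesis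
  `OldSteinbergAvoidanceModP N p f := AvoidsModP N p (isotypicPeriodLattice N f) (steinbergOldPeriodLattice N p)`
  (es: «F̄ ∩ Ō_St = 0», at `p = 2`, `4 ∥ N`).
* Unfolding lemmas `mem_*_iff`, `*_le_periodHomology`, `le_periodHomologySaturation`,
  `isotypicPeriodLattice_saturated`.

Scope (stated, not hidden): no claim is made that `w_Q^∨` preserves `H`, that these lattices have the expected
ranks, or that `OldSteinbergAvoidanceModP` implies anything about Manin constants — those are the cell's
candidate rows (E-es-45/46), not Literature.

## References

* [CremonaAlgorithms1997] J. E. Cremona, *Algorithms for Modular Elliptic Curves* (2nd ed., 1997), §2.1 (2.1.1)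
  (`H₁(X₀(N), ℤ)` as period functionals), §2.4 (2.4.1)–(2.4.2) (Hecke action on modular symbols; `T_p` for
  `p ∣ N`), §2.14 (`W_q` operators). [cite: CremonaAlgorithms1997, §2.1, §2.4, §2.14]
* [Knapp1993] A. W. Knapp, *Elliptic Curves* (1993), Lemma 9.24, Thm. 9.27 (Atkin–Lehner involutions `w_Q`).
  [cite: Knapp1993, Lemma 9.24]
-/

noncomputable section

open scoped MatrixGroups ModularForm
open CongruenceSubgroup UpperHalfPlane

namespace Literature.NumberTheory.EllipticCurves.ModularForms

variable (N : ℕ) [NeZero N]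

/-! ## Hecke and Atkin–Lehner on (integral) homology -/

/-- **`w_Q^∨`**, the transpose of the Atkin–Lehner involution `w_Q` (`Q ∥ N`) on `S₂(Γ₀(N))^∧` (ambient dual
space; its restriction to `H₁(X₀(N), ℤ)` is not asserted here). [cite: Knapp1993, Lemma 9.24] -/
def atkinLehnerDual (Q : ℕ) [NeZero Q] :
    Module.Dual ℂ (CuspForm (Gamma0 N) 2) →ₗ[ℂ] Module.Dual ℂ (CuspForm (Gamma0 N) 2) :=
  (atkinLehnerInvolution N 2 Q).dualMap

/-- **`w_{Q_p}^∨`** for the exact power `Q_p = p^{v_p(N)}` (transpose of `atkinLehnerInvolutionAt N 2 p`).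
[cite: Knapp1993, Lemma 9.24] -/
def atkinLehnerDualAt (p : ℕ) :
    Module.Dual ℂ (CuspForm (Gamma0 N) 2) →ₗ[ℂ] Module.Dual ℂ (CuspForm (Gamma0 N) 2) :=
  (atkinLehnerInvolutionAt N 2 p).dualMap

/-- Unfolding `atkinLehnerDual`. [cite: Knapp1993, Lemma 9.24] -/
theorem atkinLehnerDual_apply (Q : ℕ) [NeZero Q] (φ : Module.Dual ℂ (CuspForm (Gamma0 N) 2))
    (h : CuspForm (Gamma0 N) 2) : atkinLehnerDual N Q φ h = φ (atkinLehnerInvolution N 2 Q h) :=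
  rfl

/-- Unfolding `atkinLehnerDualAt`. [cite: Knapp1993, Lemma 9.24] -/
theorem atkinLehnerDualAt_apply (p : ℕ) (φ : Module.Dual ℂ (CuspForm (Gamma0 N) 2))
    (h : CuspForm (Gamma0 N) 2) : atkinLehnerDualAt N p φ h = φ (atkinLehnerInvolutionAt N 2 p h) :=
  rfl

/-! ## Saturation of a sublattice inside `H₁(X₀(N), ℤ)` -/

/-- **Saturation in the period homology**: for a subgroup `L ⊆ S₂(Γ₀(N))^∧`, the elements `φ ∈ H = periodHomology N`
with `n • φ ∈ L` for some integer `n ≥ 1`, i.e. `sat_H(L) = (ℚ L) ∩ H` (the `…^{sat}` of es's engine).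
[cite: CremonaAlgorithms1997, §2.1 (2.1.1) (the integral homology as a lattice of functionals)] -/
def periodHomologySaturation (L : AddSubgroup (Module.Dual ℂ (CuspForm (Gamma0 N) 2))) :
    AddSubgroup (Module.Dual ℂ (CuspForm (Gamma0 N) 2)) where
  carrier := {φ | φ ∈ periodHomology N ∧ ∃ n : ℕ, n ≠ 0 ∧ (n : ℤ) • φ ∈ L}
  add_mem' := by
    rintro φ ψ ⟨hφ, n, hn, hnφ⟩ ⟨hψ, m, hm, hmψ⟩
    refine ⟨add_mem hφ hψ, n * m, mul_ne_zero hn hm, ?_⟩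
    have e : ((n * m : ℕ) : ℤ) • (φ + ψ) = (m : ℤ) • ((n : ℤ) • φ) + (n : ℤ) • ((m : ℤ) • ψ) := by
      rw [smul_add, smul_smul, smul_smul, Nat.cast_mul, mul_comm (m : ℤ)]
    rw [e]
    exact add_mem (L.zsmul_mem hnφ m) (L.zsmul_mem hmψ n)
  zero_mem' := ⟨zero_mem _, 1, one_ne_zero, by rw [smul_zero]; exact zero_mem _⟩
  neg_mem' := by
    rintro φ ⟨hφ, n, hn, hnφ⟩
    exact ⟨neg_mem hφ, n, hn, by rw [smul_neg]; exact neg_mem hnφ⟩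

variable {N} in
/-- Membership in the saturation. [cite: CremonaAlgorithms1997, §2.1 (2.1.1)] -/
theorem mem_periodHomologySaturation_iff {L : AddSubgroup (Module.Dual ℂ (CuspForm (Gamma0 N) 2))}
    {φ : Module.Dual ℂ (CuspForm (Gamma0 N) 2)} :
    φ ∈ periodHomologySaturation N L ↔ φ ∈ periodHomology N ∧ ∃ n : ℕ, n ≠ 0 ∧ (n : ℤ) • φ ∈ L :=
  Iff.rfl

/-- The saturation lies in the period homology. [cite: CremonaAlgorithms1997, §2.1 (2.1.1)] -/
theorem periodHomologySaturation_le (L : AddSubgroup (Module.Dual ℂ (CuspForm (Gamma0 N) 2))) :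
    periodHomologySaturation N L ≤ periodHomology N := fun _ h => h.1

/-- `L ∩ H ⊆ sat_H(L)`. [cite: CremonaAlgorithms1997, §2.1 (2.1.1)] -/
theorem inf_le_periodHomologySaturation (L : AddSubgroup (Module.Dual ℂ (CuspForm (Gamma0 N) 2))) :
    L ⊓ periodHomology N ≤ periodHomologySaturation N L := fun _ h =>
  ⟨h.2, 1, one_ne_zero, by rw [Nat.cast_one, one_smul]; exact h.1⟩

/-! ## The `f`-isotypic sublattice `Λ′_f = H ∩ V_f` -/

/-- **The `f`-isotypic sublattice** `Λ′_f = H₁(X₀(N), ℤ) ∩ V_f`: the integral classes on which every transposed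
Hecke operator `T_p^∨` (`p` prime; `= U_p^∨` for `p ∣ N`) acts by the `q`-expansion coefficient `a_p(f)` (for a
normalised newform `f`, `T_p f = a_p(f) f`: `IsNewform0.heckeT_eq_coeff_smul`). es §26: `F = H ∩ V_f`, `F̄ = F/2F`.
[cite: CremonaAlgorithms1997, §2.1 (2.1.1), §2.4] -/
def isotypicPeriodLattice (f : CuspForm (Gamma0 N) 2) : AddSubgroup (Module.Dual ℂ (CuspForm (Gamma0 N) 2)) where
  carrier := {φ | φ ∈ periodHomology N ∧ ∀ (p : ℕ) [NeZero p], p.Prime →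
    (heckeT (Gamma0 N) 2 p).dualMap φ = (qExpansion 1 ⇑f).coeff p • φ}
  add_mem' := by
    rintro φ ψ ⟨hφ, hφ'⟩ ⟨hψ, hψ'⟩
    refine ⟨add_mem hφ hψ, fun p _ hp => ?_⟩
    rw [map_add, hφ' p hp, hψ' p hp, smul_add]
  zero_mem' := ⟨zero_mem _, fun p _ _ => by rw [map_zero, smul_zero]⟩
  neg_mem' := by
    rintro φ ⟨hφ, hφ'⟩
    exact ⟨neg_mem hφ, fun p _ hp => by rw [map_neg, hφ' p hp, smul_neg]⟩

variable {N} in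
/-- Membership in the `f`-isotypic sublattice. [cite: CremonaAlgorithms1997, §2.4] -/
theorem mem_isotypicPeriodLattice_iff {f : CuspForm (Gamma0 N) 2} {φ : Module.Dual ℂ (CuspForm (Gamma0 N) 2)} :
    φ ∈ isotypicPeriodLattice N f ↔ φ ∈ periodHomology N ∧ ∀ (p : ℕ) [NeZero p], p.Prime →
      (heckeT (Gamma0 N) 2 p).dualMap φ = (qExpansion 1 ⇑f).coeff p • φ :=
  Iff.rfl

/-- `Λ′_f ⊆ H`. [cite: CremonaAlgorithms1997, §2.1 (2.1.1)] -/
theorem isotypicPeriodLattice_le (f : CuspForm (Gamma0 N) 2) : isotypicPeriodLattice N f ≤ periodHomology N :=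
  fun _ h => h.1

/-- `Λ′_f` is saturated in `H`: `sat_H(Λ′_f) = Λ′_f` (an eigen-relation survives division by `n ≠ 0` in the
`ℂ`-vector space `S₂^∧`). [cite: CremonaAlgorithms1997, §2.4] -/
theorem periodHomologySaturation_isotypicPeriodLattice (f : CuspForm (Gamma0 N) 2) :
    periodHomologySaturation N (isotypicPeriodLattice N f) = isotypicPeriodLattice N f := by
  apply le_antisymm
  · rintro φ ⟨hφ, n, hn, hmem⟩
    refine ⟨hφ, fun p _ hp => ?_⟩
    have h := hmem.2 p hp
    rw [map_zsmul, smul_comm] at h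
    exact smul_right_injective _ (Int.natCast_ne_zero.mpr hn) h
  · intro φ hφ
    exact inf_le_periodHomologySaturation N _ ⟨hφ, hφ.1⟩

/-! ## The `p`-Steinberg-old sublattice `O_St^{sat}` -/

/-- **`ker(U_p^∨ ∘ U_p^∨ − 1)` on the integral homology**: `{φ ∈ H | U_p^∨ (U_p^∨ φ) = φ}` (es §26.2: at
`N = 4M` the `2`-Steinberg old packet `{g, g|B₂}`, `a₂(g) = ±1`, carries `U₂ = (a₂ 1; 0 0)`, so this kernel is
the line of `g`). [cite: CremonaAlgorithms1997, §2.4 (2.4.1)-(2.4.2) (U_p on modular symbols, p ∣ N)] -/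
def steinbergKernel (p : ℕ) [NeZero p] : AddSubgroup (Module.Dual ℂ (CuspForm (Gamma0 N) 2)) where
  carrier := {φ | φ ∈ periodHomology N ∧
    (heckeT (Gamma0 N) 2 p).dualMap ((heckeT (Gamma0 N) 2 p).dualMap φ) = φ}
  add_mem' := by
    rintro φ ψ ⟨hφ, hφ'⟩ ⟨hψ, hψ'⟩
    refine ⟨add_mem hφ hψ, ?_⟩
    rw [map_add, map_add, hφ', hψ']
  zero_mem' := ⟨zero_mem _, by rw [map_zero, map_zero]⟩
  neg_mem' := by
    rintro φ ⟨hφ, hφ'⟩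
    exact ⟨neg_mem hφ, by rw [map_neg, map_neg, hφ']⟩

variable {N} in
/-- Membership in `steinbergKernel`. [cite: CremonaAlgorithms1997, §2.4 (2.4.1)-(2.4.2)] -/
theorem mem_steinbergKernel_iff {p : ℕ} [NeZero p] {φ : Module.Dual ℂ (CuspForm (Gamma0 N) 2)} :
    φ ∈ steinbergKernel N p ↔ φ ∈ periodHomology N ∧
      (heckeT (Gamma0 N) 2 p).dualMap ((heckeT (Gamma0 N) 2 p).dualMap φ) = φ :=
  Iff.rfl

/-- **The `p`-Steinberg-old sublattice** `O_St^{sat} = sat_H( ker(U_p^{∨2} − 1) + w_{Q_p}^∨ ker(U_p^{∨2} − 1) )`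
(es MEMO §26 / engine e26.gp «O_St^{sat} = sat(ker(U₂²−1) + W₄ ker(U₂²−1))»; `Q_p = p^{v_p(N)}`, so `w_{Q_2} = w_4`
at `4 ∥ N`). The `w^∨`-translate is taken in the ambient dual space and the result is cut back to `H` by the
saturation. [cite: CremonaAlgorithms1997, §2.4, §2.14 (W_q on modular symbols)] -/
def steinbergOldPeriodLattice (p : ℕ) [NeZero p] : AddSubgroup (Module.Dual ℂ (CuspForm (Gamma0 N) 2)) :=
  periodHomologySaturation N
    (AddSubgroup.closure ((steinbergKernel N p : Set (Module.Dual ℂ (CuspForm (Gamma0 N) 2))) ∪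
      atkinLehnerDualAt N p '' (steinbergKernel N p : Set (Module.Dual ℂ (CuspForm (Gamma0 N) 2)))))

/-- `O_St^{sat} ⊆ H`. [cite: CremonaAlgorithms1997, §2.1 (2.1.1)] -/
theorem steinbergOldPeriodLattice_le (p : ℕ) [NeZero p] : steinbergOldPeriodLattice N p ≤ periodHomology N :=
  periodHomologySaturation_le N _

/-- `ker(U_p^{∨2} − 1) ∩ H ⊆ O_St^{sat}`. [cite: CremonaAlgorithms1997, §2.4] -/
theorem steinbergKernel_le_steinbergOldPeriodLattice (p : ℕ) [NeZero p] :
    steinbergKernel N p ≤ steinbergOldPeriodLattice N p := fun _ h =>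
  inf_le_periodHomologySaturation N _ ⟨AddSubgroup.subset_closure (Or.inl h), h.1⟩

/-! ## Congruence of sublattices modulo `p H`: «avoidance» -/

/-- **`Ā ∩ B̄ = 0` in `H/pH`** for two subgroups `A, B ⊆ S₂(Γ₀(N))^∧` (each cut back to `H = periodHomology N`):
whenever `x ∈ A ∩ H` and `y ∈ B ∩ H` are congruent modulo `p H`, `x ∈ p H` (so the images of `A ∩ H` and
`B ∩ H` in `H ⊗ 𝔽_p` meet trivially). Written without quotient modules. [cite: CremonaAlgorithms1997, §2.1 (2.1.1)] -/
def AvoidsModP (p : ℕ) (A B : AddSubgroup (Module.Dual ℂ (CuspForm (Gamma0 N) 2))) : Prop :=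
  ∀ x ∈ A, x ∈ periodHomology N → ∀ y ∈ B, y ∈ periodHomology N →
    (∃ h ∈ periodHomology N, x - y = (p : ℤ) • h) → ∃ h ∈ periodHomology N, x = (p : ℤ) • h

variable {N} in
/-- `AvoidsModP` is symmetric. [cite: CremonaAlgorithms1997, §2.1 (2.1.1)] -/
theorem AvoidsModP.symm {p : ℕ} {A B : AddSubgroup (Module.Dual ℂ (CuspForm (Gamma0 N) 2))}
    (h : AvoidsModP N p A B) : AvoidsModP N p B A := by
  intro y hy hyH x hx hxH hxy
  obtain ⟨k, hk, hk'⟩ := hxy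
  obtain ⟨h₁, hh₁, hh₁'⟩ := h x hx hxH y hy hyH ⟨-k, neg_mem hk, by rw [smul_neg, ← hk', neg_sub]⟩
  refine ⟨k + h₁, add_mem hk hh₁, ?_⟩
  rw [smul_add, ← hh₁', ← hk', sub_add_cancel]

/-- **OLD-STEINBERG AVOIDANCE MOD `p`** for `f ∈ S₂(Γ₀(N))` (es §26, the Betti-level sufficient condition of the
toric-duality mechanism, hypothesis of its candidate rows E-es-45/46 at `p = 2`, `4 ∥ N`): the `f`-isotypic
sublattice and the `p`-Steinberg-old sublattice of `H₁(X₀(N), ℤ)` have trivially meeting images in `H/pH` —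
«`F̄ ∩ Ō_St = 0`». A DEFINITION (a property of `(N, p, f)`); nothing is asserted about when it holds or what it
implies. [cite: CremonaAlgorithms1997, §2.1, §2.4, §2.14 (shape only: the integral-homology vocabulary; the property is the cell's, MEMO-es §26)] -/
def OldSteinbergAvoidanceModP (p : ℕ) [NeZero p] (f : CuspForm (Gamma0 N) 2) : Prop :=
  AvoidsModP N p (isotypicPeriodLattice N f) (steinbergOldPeriodLattice N p)

variable {N} in
/-- Unfolding `OldSteinbergAvoidanceModP`. [cite: CremonaAlgorithms1997, §2.1 (shape only)] -/
theorem oldSteinbergAvoidanceModP_iff {p : ℕ} [NeZero p] {f : CuspForm (Gamma0 N) 2} :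
    OldSteinbergAvoidanceModP N p f ↔
      ∀ x ∈ isotypicPeriodLattice N f, ∀ y ∈ steinbergOldPeriodLattice N p,
        (∃ h ∈ periodHomology N, x - y = (p : ℤ) • h) → ∃ h ∈ periodHomology N, x = (p : ℤ) • h := by
  constructor
  · intro h x hx y hy hxy
    exact h x hx hx.1 y hy (steinbergOldPeriodLattice_le N p hy) hxy
  · intro h x hx _ y hy _ hxy
    exact h x hx y hy hxy

end Literature.NumberTheory.EllipticCurves.ModularForms

end
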